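import Summits.AtomisticToContinuum.Crystallization.Theorems.ContactSaturationLadderCrossTermFloor
import Summits.AtomisticToContinuum.Crystallization.Theorems.PerronTransitivityUniformBindingRigidityCohesionL

/-!
# ContactSaturationLadder · E₁ `LooseTextureRung` · SPARSE(1;1) — the removal floor of the ISOLATED class (helper, supports item 30303)

Lens-1 g35 (critic row 447 (A3), order «FIRST close SPARSE(1;1)»).  The SPARSE(m;δ) piece of the cut of record
(`UnmarkedChunkExclusionF (coordMarker m) δ`, g34 §45) follows from ONE inequality `ChunkRemovalFloor (coordMarker m) α D` with a
removal rate `α` below a competitor density `γ` (`sparse_of_floor`).  This file proves the inequality for `m = 1` — the class of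
windows all of whose particles are ISOLATED at scale `7/5` (no other particle within `7/5`) — in RAW, def-free form, with the EXACT
rational rate

  `α₁ = S₁/12 = 321875/705894 = 0.45598…`,  `S₁ = T(7/5, 7/5) − (7/5)⁻⁶ = (206/5)·(5/7)⁶ = 643750/117649 = 5.4718…`,

where `T(δ, R) = 16/(δ³R³) + 18/(δ²R⁴) + 36/(5δR⁵) + 1/R⁶ = ∫_R^∞ 6 (2s/δ+1)³ s⁻⁷ ds` is the sharp volumetric (layer-cake / Abel)
bound for the sixth-power sum over a `δ`-separated set beyond radius `R`, here with `δ = R = 7/5` and credit `1·R⁻⁶` for the centre.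
Since `α₁ < 23/50 < 1/2`, SPARSE(1;δ) follows for every `δ` from any competitor density `γ > 0.456` — in particular from
`Competitor (1/2)` (the Mie ladder's `E(n)/n ≤ −1/2` eventually; tree, modulo an unbuilt import chain at the time of writing).

Contents (all `[folklore]`; energy in the tree's units `V_LJ(r) = r⁻¹²/12 − r⁻⁶/6`, minimum `−1/12`):
* §1 the LAYER-CAKE inequalities and the discrete Abel summation `sum_inv_pow_six_le_sharp_aux` — verbatim, self-contained copies
  (Mathlib only) of `…PerronTransitivityUniformBindingRigidity.sum_inv_pow_six_le_sharp_aux` and its three lemmas (that module's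
  import chain `…CohesionI‥L` is not built on the farm at the time of writing, so it cannot be imported; the copies carry a prime);
* §2 `shellSum_isolated_le`: for a finite index set `A` whose sites are pairwise `≥ 7/5` apart and `a ∈ A`,
  `Σ_{b ∈ A∖a} |y_a − y_b|⁻⁶ ≤ 643750/117649`;
* §3 `crossFloor_of_sep`: the GROUND-STATE-FREE cross-term floor — for an injective `δ`-separated configuration (`0 < δ ≤ 1`),
  every centre `p` and every `ρ ≥ 4`: `Σ_{i ∈ B(p,ρ)} Σ_{k ∉ B(p,ρ)} V_LJ ≥ −C(δ)·ρ²` (the bookkeeping of the landed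
  `…CrossTermFloor.stub_crossTermFloor` on its landed unit-layer lemmas `site_tail/site_skin/layer_card/core_card/sum_inv_cube_le`,
  with the hard core `δ` a HYPOTHESIS instead of `LennardJonesMinimalDistance_holds`, and `48(ρ+1)² ≤ 75ρ²` for `ρ ≥ 4` instead of
  `≤ 60ρ²` for `ρ ≥ 9`);
* §4 `removalFloor_isolated` (+ the rounded `removalFloor_isolated_23_50`): for an injective `7/10`-separated configuration, every centre
  `c`, every `r ≥ 2`, if every particle of the window `A = B(c, 2r)` has no other particle within `7/5`, then
  `D_A + 2·I_A ≥ −(2·α₁·#A + D·r²)` (`D_A = Σ_{a,b ∈ A} V_LJ`, `I_A = Σ_{a ∈ A, b ∉ A} V_LJ`): inner pairs priced at `V_LJ(d) ≥ −d⁻⁶/6`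
  and summed by §2, the diagonal is `V_LJ(0) = 0` (tree `lennardJones_zero`), the cross term by §3 with `ρ = 2r`.

No `def`, no `instance`, no `notation`, no `axiom`, no `sorry`.  Imports only the landed `…Theorems.ContactSaturationLadderCrossTermFloor`.
-/

noncomputable section

namespace Summit.AtomisticToContinuum.Crystallization.Theorems.ContactSaturationLadderSparseRungOne

open scoped BigOperators Classical
open Summit.AtomisticToContinuum.Crystallization.Theorems.PerronTransitivityUniformBindingRigidity (packing_mul_inv_pow_six_le
  packing_mul_inv_pow_six_sub_le cube_mul_inv_pow_six_sub_le sum_inv_pow_six_le_sharp_aux mul_inv_pow_six_sub_le sq_mul_inv_pow_six_sub_le)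
open Metric
open Literature.MathematicalPhysics.StatisticalMechanics (lennardJones lennardJones_zero neg_le_lennardJones_of_le
  card_le_of_separated_of_dist_le)
open Summit.AtomisticToContinuum.Crystallization.Theorems.ContactSaturationLadderCrossTermFloor (site_tail site_skin layer_card
  core_card sum_inv_cube_le)

variable {N : ℕ}

/-! ## §1 The layer-cake inequalities and the discrete Abel summation are CITED (unprimed names) from
`PerronTransitivityUniformBindingRigidityCohesionL` — gate dedup (`dedup.landed`) of the g35 self-contained primed copies, as the g35
landing ask pre-approved; landed by prover hand 1, gen 11 (source `land/ContactSaturationLadderSparseRungOne.lean` sha256 3e08c7d2…). -/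

/-! ## §2 The shell sum of the ISOLATED class: `Σ_{b ∈ A∖a} |y_a − y_b|⁻⁶ ≤ 643750/117649 = 5.4718…` -/

/-- `T(7/5, 7/5) − (7/5)⁻⁶ = 643750/117649` (`= (206/5)·(5/7)⁶`). -/
theorem sharpTail_seven_fifths :
    (16 / ((7 / 5 : ℝ) ^ 3 * (7 / 5) ^ 3) + 18 / ((7 / 5) ^ 2 * (7 / 5) ^ 4) + 36 / (5 * (7 / 5) * (7 / 5) ^ 5) +
        1 / (7 / 5) ^ 6) - (7 / 5 : ℝ)⁻¹ ^ 6 = 643750 / 117649 := by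
  norm_num

/-- **The isolated-class shell sum.** If the sites `y b`, `b ∈ A`, of an injective configuration are pairwise at distance `≥ 7/5`,
then for every `a ∈ A`: `Σ_{b ∈ A∖a} |y_a − y_b|⁻⁶ ≤ T(7/5,7/5) − (7/5)⁻⁶ = 643750/117649` — the discrete Abel summation of §1 with
`δ = R = 7/5` and credit `m = 1` for the centre `y a` (the counting hypothesis is the volumetric packing count
`card_le_of_separated_of_dist_le` applied to `{y a} ∪ {y b : |y b − y a| ≤ |y q − y a|}`). [folklore] -/
theorem shellSum_isolated_le (y : Fin N → EuclideanSpace ℝ (Fin 3)) (hy : Function.Injective y) (A : Finset (Fin N))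
    (hA : ∀ a ∈ A, ∀ b ∈ A, a ≠ b → (7 : ℝ) / 5 ≤ dist (y a) (y b)) {a : Fin N} (ha : a ∈ A) :
    ∑ b ∈ A.erase a, (dist (y a) (y b))⁻¹ ^ 6 ≤ 643750 / 117649 := by
  set s : Finset (EuclideanSpace ℝ (Fin 3)) := (A.erase a).image y with hs
  have hδ : (0 : ℝ) < 7 / 5 := by norm_num
  have hsum : ∑ b ∈ A.erase a, (dist (y a) (y b))⁻¹ ^ 6 = ∑ q ∈ s, (dist q (y a))⁻¹ ^ 6 := by
    rw [hs, Finset.sum_image (fun b _ c _ h => hy h)]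
    refine Finset.sum_congr rfl fun b _ => ?_
    rw [dist_comm]
  have hfar : ∀ q ∈ s, (7 : ℝ) / 5 ≤ dist q (y a) := by
    intro q hq
    obtain ⟨b, hb, rfl⟩ := Finset.mem_image.1 hq
    have hba : b ≠ a := (Finset.mem_erase.1 hb).1
    have hbA : b ∈ A := (Finset.mem_erase.1 hb).2
    rw [dist_comm]
    exact hA a ha b hbA hba.symm
  have hcount : ∀ q ∈ s, ((1 : ℕ) : ℝ) + ((s.filter fun q' => dist q' (y a) ≤ dist q (y a)).card : ℝ) ≤
      (2 * dist q (y a) / (7 / 5) + 1) ^ 3 := by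
    intro q hq
    have hpnot : y a ∉ s.filter (fun q' => dist q' (y a) ≤ dist q (y a)) := by
      intro h
      obtain ⟨b, hb, hbp⟩ := Finset.mem_image.1 (Finset.mem_filter.1 h).1
      exact (Finset.mem_erase.1 hb).1 (hy hbp)
    have hcard : ((insert (y a) (s.filter fun q' => dist q' (y a) ≤ dist q (y a))).card : ℝ) =
        1 + ((s.filter fun q' => dist q' (y a) ≤ dist q (y a)).card : ℝ) := by
      rw [Finset.card_insert_of_notMem hpnot]
      push_cast
      ring
    have hin : ∀ c ∈ insert (y a) (s.filter fun q' => dist q' (y a) ≤ dist q (y a)), dist c (y a) ≤ dist q (y a) := by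
      intro c hc
      rcases Finset.mem_insert.1 hc with rfl | hc
      · rw [dist_self]; exact dist_nonneg
      · exact (Finset.mem_filter.1 hc).2
    have hmemA : ∀ c ∈ insert (y a) (s.filter fun q' => dist q' (y a) ≤ dist q (y a)), ∃ b ∈ A, y b = c := by
      intro c hc
      rcases Finset.mem_insert.1 hc with rfl | hc
      · exact ⟨a, ha, rfl⟩
      · obtain ⟨b, hb, hbc⟩ := Finset.mem_image.1 (Finset.mem_filter.1 hc).1
        exact ⟨b, (Finset.mem_erase.1 hb).2, hbc⟩
    have hsep' : ∀ c ∈ insert (y a) (s.filter fun q' => dist q' (y a) ≤ dist q (y a)),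
        ∀ d ∈ insert (y a) (s.filter fun q' => dist q' (y a) ≤ dist q (y a)), c ≠ d → (7 : ℝ) / 5 ≤ dist c d := by
      intro c hc d hd hcd
      obtain ⟨b, hb, rfl⟩ := hmemA c hc
      obtain ⟨b', hb', rfl⟩ := hmemA d hd
      exact hA b hb b' hb' (fun h => hcd (by rw [h]))
    have h := card_le_of_separated_of_dist_le (insert (y a) (s.filter fun q' => dist q' (y a) ≤ dist q (y a))) (y a) hδ
      dist_nonneg hin hsep'
    rw [finrank_euclideanSpace_fin, hcard] at h
    simpa using h
  have hmain := sum_inv_pow_six_le_sharp_aux hδ (y a) s.card s 1 (7 / 5) rfl hδ (by norm_num) hfar hcount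
  rw [hsum]
  have hT := sharpTail_seven_fifths
  simp only [Nat.cast_one, one_mul] at hmain
  linarith

/-! ## §3 The ground-state-free cross-term floor: `Σ_{i ∈ B(p,ρ)} Σ_{k ∉ B(p,ρ)} V_LJ ≥ −C(δ)·ρ²` (`ρ ≥ 4`) -/

/-- **Cross-term floor for a separated configuration.** For `0 < δ ≤ 1` there is `C = C(δ)` such that for every injective
`δ`-separated configuration, every centre `p` and every `ρ ≥ 4`, the cross energy of the ball window `B(p, ρ)` with its complement
is `≥ −C·ρ²`.  (The bookkeeping of the landed `stub_crossTermFloor` with the hard core as a hypothesis: core sites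
`|y_i − p| ≤ ρ/2` see the outside beyond `ρ/2` (`site_tail`, `core_card`), the unit layer at integer depth `m ≤ ρ/2` holds
`≤ 48δ⁻³(ρ+1)² ≤ 75δ⁻³ρ²` sites (`layer_card`) each seeing the outside beyond `m` (`site_tail`; the skin `m = 0` by `site_skin`),
and `Σ_m (m+1)⁻³ ≤ 2` (`sum_inv_cube_le`).) [folklore] -/
theorem crossFloor_of_sep {δ : ℝ} (hδ : 0 < δ) (hδ1 : δ ≤ 1) :
    ∃ C : ℝ, ∀ (N : ℕ) (y : Fin N → EuclideanSpace ℝ (Fin 3)), Function.Injective y →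
      (∀ k l : Fin N, k ≠ l → δ ≤ dist (y k) (y l)) → ∀ (p : EuclideanSpace ℝ (Fin 3)) (ρ : ℝ), 4 ≤ ρ →
        -(C * ρ ^ 2) ≤ ∑ i ∈ (Finset.univ.filter fun i : Fin N => dist (y i) p ≤ ρ),
            ∑ k ∈ (Finset.univ.filter fun i : Fin N => dist (y i) p ≤ ρ)ᶜ, lennardJones (dist (y i) (y k)) := by
  set A : ℝ := (1 / 6) * (250 * δ⁻¹ ^ 3) with hA
  have hA0 : 0 < A := by rw [hA]; positivity
  set D : ℝ := 64 * A * δ⁻¹ ^ 3 + 75 * δ⁻¹ ^ 3 * (A * δ⁻¹ ^ 3 + 2 * A) with hD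
  refine ⟨D, ?_⟩
  intro N y hyinj hsep p ρ hρ4
  have hρ0 : 0 < ρ := by linarith
  set W := Finset.univ.filter (fun i : Fin N => dist (y i) p ≤ ρ) with hW
  set T := Wᶜ with hT
  have hmW : ∀ i : Fin N, i ∈ W ↔ dist (y i) p ≤ ρ := fun i => by rw [hW]; simp
  have hmT : ∀ k : Fin N, k ∈ T → ρ < dist (y k) p := fun k hk => by
    rw [hT, Finset.mem_compl, hmW] at hk
    exact not_le.1 hk
  have hTi : ∀ i ∈ W, ∀ k ∈ T, k ≠ i := fun i hi k hk h => by
    rw [hT, Finset.mem_compl] at hk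
    exact hk (h ▸ hi)
  -- split the window into the core `|y_i − p| ≤ ρ/2` and the outer half
  rw [← Finset.sum_filter_add_sum_filter_not W (fun i : Fin N => dist (y i) p ≤ ρ / 2)]
  set K := W.filter (fun i : Fin N => dist (y i) p ≤ ρ / 2) with hK
  set O := W.filter (fun i : Fin N => ¬ dist (y i) p ≤ ρ / 2) with hO
  ------------------------------------------------------------------ the core
  have hcore_site : ∀ i ∈ K, -(A * (ρ / 2)⁻¹ ^ 3) ≤ ∑ k ∈ T, lennardJones (dist (y i) (y k)) := by
    intro i hi
    have hi' : dist (y i) p ≤ ρ / 2 := (Finset.mem_filter.1 hi).2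
    have h := site_tail y hδ hsep p ρ T hmT (r := ρ / 2) (by linarith) (i := i) (by linarith)
    have hA' : (1 / 6) * (250 * δ⁻¹ ^ 3 * (ρ / 2)⁻¹ ^ 3) = A * (ρ / 2)⁻¹ ^ 3 := by rw [hA]; ring
    linarith
  have hKcard : (K.card : ℝ) ≤ 8 * ρ ^ 3 * δ⁻¹ ^ 3 := by
    have hKW : K = Finset.univ.filter (fun i : Fin N => dist (y i) p ≤ ρ / 2) := by
      ext i
      rw [hK, Finset.mem_filter, hmW]
      simp only [Finset.mem_filter, Finset.mem_univ, true_and]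
      constructor
      · exact fun h => h.2
      · exact fun h => ⟨by linarith, h⟩
    rw [hKW]
    have h := core_card y hyinj hδ hsep p (R := ρ / 2) (by linarith)
    have h1 : 2 * (ρ / 2) / δ + 1 ≤ 2 * ρ / δ := by
      rw [show 2 * (ρ / 2) / δ = ρ / δ by ring, show 2 * ρ / δ = 2 * (ρ / δ) by ring]
      have : 1 ≤ ρ / δ := by rw [le_div_iff₀ hδ]; linarith
      linarith
    have h0 : 0 ≤ 2 * (ρ / 2) / δ + 1 := by positivity
    calc ((Finset.univ.filter fun i : Fin N => dist (y i) p ≤ ρ / 2).card : ℝ) ≤ (2 * (ρ / 2) / δ + 1) ^ 3 := h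
      _ ≤ (2 * ρ / δ) ^ 3 := pow_le_pow_left₀ h0 h1 3
      _ = 8 * ρ ^ 3 * δ⁻¹ ^ 3 := by ring
  have hcore : -(64 * A * δ⁻¹ ^ 3) ≤ ∑ i ∈ K, ∑ k ∈ T, lennardJones (dist (y i) (y k)) := by
    have h1 := Finset.sum_le_sum hcore_site
    rw [Finset.sum_const, nsmul_eq_mul] at h1
    have h2 : (ρ / 2)⁻¹ ^ 3 = 8 * ρ⁻¹ ^ 3 := by
      rw [inv_div, div_eq_mul_inv, mul_pow]
      norm_num
    have h3 : ρ ^ 3 * ρ⁻¹ ^ 3 = 1 := by rw [← mul_pow, mul_inv_cancel₀ hρ0.ne', one_pow]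
    have h4 : (K.card : ℝ) * (A * (ρ / 2)⁻¹ ^ 3) ≤ 64 * A * δ⁻¹ ^ 3 := by
      rw [h2]
      calc (K.card : ℝ) * (A * (8 * ρ⁻¹ ^ 3)) ≤ (8 * ρ ^ 3 * δ⁻¹ ^ 3) * (A * (8 * ρ⁻¹ ^ 3)) :=
            mul_le_mul_of_nonneg_right hKcard (by positivity)
        _ = 64 * A * δ⁻¹ ^ 3 * (ρ ^ 3 * ρ⁻¹ ^ 3) := by ring
        _ = 64 * A * δ⁻¹ ^ 3 := by rw [h3, mul_one]
    have h5 : (K.card : ℝ) * -(A * (ρ / 2)⁻¹ ^ 3) = -((K.card : ℝ) * (A * (ρ / 2)⁻¹ ^ 3)) := by ring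
    linarith
  ------------------------------------------------------------------ the outer half, by unit layers
  set dep : Fin N → ℕ := fun i => ⌊ρ - dist (y i) p⌋₊ with hdep
  set M' : ℕ := ⌊ρ / 2⌋₊ with hM'
  set w : ℕ → ℝ := fun m => if m = 0 then A * δ⁻¹ ^ 3 else A * (m : ℝ)⁻¹ ^ 3 with hw
  have hmaps : ∀ i ∈ O, dep i ∈ Finset.range (M' + 1) := by
    intro i hi
    have hiO : ¬ dist (y i) p ≤ ρ / 2 := (Finset.mem_filter.1 hi).2
    rw [Finset.mem_range, Nat.lt_add_one_iff]
    apply Nat.floor_le_floor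
    linarith [not_le.1 hiO]
  have hfiber : ∀ m ∈ Finset.range (M' + 1),
      -(48 * δ⁻¹ ^ 3 * (ρ + 1) ^ 2 * w m) ≤ ∑ i ∈ O.filter (fun i => dep i = m), ∑ k ∈ T, lennardJones (dist (y i) (y k)) := by
    intro m hm
    have hmM : m ≤ M' := Nat.lt_add_one_iff.1 (Finset.mem_range.1 hm)
    have hmρ : (m : ℝ) ≤ ρ / 2 := le_trans (Nat.cast_le.2 hmM) (Nat.floor_le (by linarith))
    have hsub : O.filter (fun i => dep i = m) ⊆
        Finset.univ.filter (fun i : Fin N => ρ - m - 1 < dist (y i) p ∧ dist (y i) p ≤ ρ - m) := by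
      intro i hi
      rw [Finset.mem_filter] at hi
      obtain ⟨hiO, hmi⟩ := hi
      have hiW : dist (y i) p ≤ ρ := (hmW i).1 (Finset.mem_filter.1 hiO).1
      have ht0 : 0 ≤ ρ - dist (y i) p := by linarith
      have h1 : ((dep i : ℕ) : ℝ) ≤ ρ - dist (y i) p := Nat.floor_le ht0
      have h2 : ρ - dist (y i) p < (dep i : ℝ) + 1 := Nat.lt_floor_add_one _
      rw [hmi] at h1 h2
      simp only [Finset.mem_filter, Finset.mem_univ, true_and]
      constructor <;> linarith
    have hsite : ∀ i ∈ O.filter (fun i => dep i = m), -w m ≤ ∑ k ∈ T, lennardJones (dist (y i) (y k)) := by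
      intro i hi
      have hiL := hsub hi
      simp only [Finset.mem_filter, Finset.mem_univ, true_and] at hiL
      have hiW : i ∈ W := (Finset.mem_filter.1 (Finset.mem_filter.1 hi).1).1
      by_cases hm0 : m = 0
      · subst hm0
        have hw0 : w 0 = A * δ⁻¹ ^ 3 := by rw [hw]; simp
        rw [hw0]
        have h := site_skin y hδ hsep T (i := i) (hTi i hiW)
        have e : (1 / 6) * (250 * δ⁻¹ ^ 6) = A * δ⁻¹ ^ 3 := by rw [hA]; ring
        linarith
      · have hm1 : (1 : ℝ) ≤ m := by exact_mod_cast Nat.one_le_iff_ne_zero.2 hm0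
        have hwm : w m = A * (m : ℝ)⁻¹ ^ 3 := by rw [hw]; simp [hm0]
        rw [hwm]
        have h := site_tail y hδ hsep p ρ T hmT (r := (m : ℝ)) (hδ1.trans hm1) (i := i) hiL.2
        have e : (1 / 6) * (250 * δ⁻¹ ^ 3 * (m : ℝ)⁻¹ ^ 3) = A * (m : ℝ)⁻¹ ^ 3 := by rw [hA]; ring
        linarith
    have hw0 : 0 ≤ w m := by
      rw [hw]
      simp only
      split_ifs <;> positivity
    have hLcard := layer_card y hδ hδ1 hsep p (ρ := ρ) (m := m) (by linarith)
    have hFcard : ((O.filter (fun i => dep i = m)).card : ℝ) ≤ 48 * δ⁻¹ ^ 3 * (ρ + 1) ^ 2 :=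
      le_trans (by exact_mod_cast Finset.card_le_card hsub) hLcard
    have h1 := Finset.sum_le_sum hsite
    rw [Finset.sum_const, nsmul_eq_mul] at h1
    have h2 : ((O.filter (fun i => dep i = m)).card : ℝ) * w m ≤ 48 * δ⁻¹ ^ 3 * (ρ + 1) ^ 2 * w m :=
      mul_le_mul_of_nonneg_right hFcard hw0
    have h3 : ((O.filter (fun i => dep i = m)).card : ℝ) * -w m = -(((O.filter (fun i => dep i = m)).card : ℝ) * w m) := by
      ring
    linarith
  have hwsum : ∑ m ∈ Finset.range (M' + 1), w m ≤ A * δ⁻¹ ^ 3 + 2 * A := by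
    rw [Finset.sum_range_succ']
    have h0 : w 0 = A * δ⁻¹ ^ 3 := by rw [hw]; simp
    have h1 : ∀ m ∈ Finset.range M', w (m + 1) = A * ((m : ℝ) + 1)⁻¹ ^ 3 := by
      intro m _
      rw [hw]
      simp only [Nat.add_one_ne_zero, if_false, Nat.cast_add, Nat.cast_one]
    rw [h0, Finset.sum_congr rfl h1, ← Finset.mul_sum]
    have h2 := sum_inv_cube_le M'
    have h3 : A * ∑ m ∈ Finset.range M', ((m : ℝ) + 1)⁻¹ ^ 3 ≤ A * 2 := mul_le_mul_of_nonneg_left h2 hA0.le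
    linarith
  have houter : -(48 * δ⁻¹ ^ 3 * (ρ + 1) ^ 2 * (A * δ⁻¹ ^ 3 + 2 * A)) ≤ ∑ i ∈ O, ∑ k ∈ T, lennardJones (dist (y i) (y k)) := by
    rw [← Finset.sum_fiberwise_of_maps_to hmaps (fun i => ∑ k ∈ T, lennardJones (dist (y i) (y k)))]
    have h1 := Finset.sum_le_sum hfiber
    have h2 : ∑ m ∈ Finset.range (M' + 1), (-(48 * δ⁻¹ ^ 3 * (ρ + 1) ^ 2 * w m))
        = -(48 * δ⁻¹ ^ 3 * (ρ + 1) ^ 2) * ∑ m ∈ Finset.range (M' + 1), w m := by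
      rw [Finset.mul_sum]
      exact Finset.sum_congr rfl fun m _ => by ring
    rw [h2] at h1
    have h3 : 0 ≤ 48 * δ⁻¹ ^ 3 * (ρ + 1) ^ 2 := by positivity
    have h4 := mul_le_mul_of_nonneg_left hwsum h3
    linarith
  ------------------------------------------------------------------ conclusion
  have h48 : 48 * (ρ + 1) ^ 2 ≤ 75 * ρ ^ 2 := by
    nlinarith [mul_nonneg (by linarith : (0 : ℝ) ≤ ρ - 4) hρ0.le]
  have hB0 : 0 ≤ A * δ⁻¹ ^ 3 + 2 * A := by positivity
  have hδ3 : 0 ≤ δ⁻¹ ^ 3 := by positivity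
  have hρ2 : 1 ≤ ρ ^ 2 := by nlinarith
  have e1 : 64 * A * δ⁻¹ ^ 3 ≤ 64 * A * δ⁻¹ ^ 3 * ρ ^ 2 := le_mul_of_one_le_right (by positivity) hρ2
  have e2 : 48 * δ⁻¹ ^ 3 * (ρ + 1) ^ 2 * (A * δ⁻¹ ^ 3 + 2 * A) ≤ 75 * δ⁻¹ ^ 3 * (A * δ⁻¹ ^ 3 + 2 * A) * ρ ^ 2 := by
    calc 48 * δ⁻¹ ^ 3 * (ρ + 1) ^ 2 * (A * δ⁻¹ ^ 3 + 2 * A)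
        = (δ⁻¹ ^ 3 * (A * δ⁻¹ ^ 3 + 2 * A)) * (48 * (ρ + 1) ^ 2) := by ring
      _ ≤ (δ⁻¹ ^ 3 * (A * δ⁻¹ ^ 3 + 2 * A)) * (75 * ρ ^ 2) := mul_le_mul_of_nonneg_left h48 (mul_nonneg hδ3 hB0)
      _ = 75 * δ⁻¹ ^ 3 * (A * δ⁻¹ ^ 3 + 2 * A) * ρ ^ 2 := by ring
  have hDρ : D * ρ ^ 2 = 64 * A * δ⁻¹ ^ 3 * ρ ^ 2 + 75 * δ⁻¹ ^ 3 * (A * δ⁻¹ ^ 3 + 2 * A) * ρ ^ 2 := by rw [hD]; ring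
  linarith [hcore, houter]

/-! ## §4 The removal floor of the ISOLATED class (`coordMarker 1`-free windows): `D_A + 2·I_A ≥ −(2·α₁·#A + D·r²)` -/

/-- **★ The removal floor of the isolated class, EXACT rate `α₁ = 321875/705894 = 0.45598…`.**  For an injective `7/10`-separated
configuration, every centre `c` and every `r ≥ 2`: if every particle of the window `A = {i : |y_i − c| ≤ 2r}` has NO other particle
within `7/5`, then `−(2·α₁·#A + D·r²) ≤ Σ_{a ∈ A} Σ_{b ∈ A} V_LJ(|y_a − y_b|) + 2·Σ_{a ∈ A} Σ_{b ∉ A} V_LJ(|y_a − y_b|)`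
(`D = 8·C(7/10)` of §3).  This is `ChunkRemovalFloor (coordMarker 1) α₁ D` of the node (§45/§47) in raw form. [folklore] -/
theorem removalFloor_isolated :
    ∃ D : ℝ, ∀ (N : ℕ) (y : Fin N → EuclideanSpace ℝ (Fin 3)), Function.Injective y →
      (∀ i j : Fin N, i ≠ j → (7 : ℝ) / 10 ≤ dist (y i) (y j)) →
        ∀ (c : EuclideanSpace ℝ (Fin 3)) (r : ℝ), 2 ≤ r →
          (∀ i : Fin N, dist (y i) c ≤ 2 * r → ∀ l : Fin N, l ≠ i → (7 : ℝ) / 5 < dist (y l) (y i)) →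
            -(2 * (321875 / 705894) * ((Finset.univ.filter fun i : Fin N => dist (y i) c ≤ 2 * r).card : ℝ) + D * r ^ 2) ≤
              ∑ a ∈ (Finset.univ.filter fun i : Fin N => dist (y i) c ≤ 2 * r),
                  ∑ b ∈ (Finset.univ.filter fun i : Fin N => dist (y i) c ≤ 2 * r), lennardJones (dist (y a) (y b)) +
                2 * ∑ a ∈ (Finset.univ.filter fun i : Fin N => dist (y i) c ≤ 2 * r),
                  ∑ b ∈ (Finset.univ.filter fun i : Fin N => dist (y i) c ≤ 2 * r)ᶜ, lennardJones (dist (y a) (y b)) := by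
  obtain ⟨C, hC⟩ := crossFloor_of_sep (δ := 7 / 10) (by norm_num) (by norm_num)
  refine ⟨8 * C, ?_⟩
  intro N y hy hsep c r hr hiso
  have hcross := hC N y hy hsep c (2 * r) (by linarith)
  set A := Finset.univ.filter (fun i : Fin N => dist (y i) c ≤ 2 * r) with hAdef
  have hmA : ∀ i : Fin N, i ∈ A ↔ dist (y i) c ≤ 2 * r := fun i => by rw [hAdef]; simp
  have hpair : ∀ a ∈ A, ∀ b ∈ A, a ≠ b → (7 : ℝ) / 5 ≤ dist (y a) (y b) := by
    intro a ha b _ hab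
    have h := hiso a ((hmA a).1 ha) b hab.symm
    rw [dist_comm]
    exact h.le
  have hinner : ∀ a ∈ A, -((1 / 6) * (643750 / 117649)) ≤ ∑ b ∈ A, lennardJones (dist (y a) (y b)) := by
    intro a ha
    rw [← Finset.add_sum_erase A _ ha, dist_self, lennardJones_zero, zero_add]
    have hterm : ∀ b ∈ A.erase a, -((1 / 6) * (dist (y a) (y b))⁻¹ ^ 6) ≤ lennardJones (dist (y a) (y b)) := by
      intro b hb
      have hba := Finset.mem_erase.1 hb
      have hd : (7 : ℝ) / 5 ≤ dist (y a) (y b) := hpair a ha b hba.2 hba.1.symm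
      exact neg_le_lennardJones_of_le (by linarith) le_rfl
    have hS := shellSum_isolated_le y hy A hpair ha
    have h1 : -((1 / 6) * ∑ b ∈ A.erase a, (dist (y a) (y b))⁻¹ ^ 6) ≤ ∑ b ∈ A.erase a, lennardJones (dist (y a) (y b)) := by
      rw [Finset.mul_sum, ← Finset.sum_neg_distrib]
      exact Finset.sum_le_sum hterm
    linarith
  have hD := Finset.sum_le_sum hinner
  rw [Finset.sum_const, nsmul_eq_mul] at hD
  have e1 : (A.card : ℝ) * -((1 / 6) * (643750 / 117649)) = -(2 * (321875 / 705894) * (A.card : ℝ)) := by ring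
  have e2 : C * (2 * r) ^ 2 = 4 * C * r ^ 2 := by ring
  linarith [hcross, hD]

/-- **The removal floor of the isolated class at the ROUNDED rate `23/50`** (`321875/705894 < 23/50 < 1/2`). -/
theorem removalFloor_isolated_23_50 :
    ∃ D : ℝ, ∀ (N : ℕ) (y : Fin N → EuclideanSpace ℝ (Fin 3)), Function.Injective y →
      (∀ i j : Fin N, i ≠ j → (7 : ℝ) / 10 ≤ dist (y i) (y j)) →
        ∀ (c : EuclideanSpace ℝ (Fin 3)) (r : ℝ), 2 ≤ r →
          (∀ i : Fin N, dist (y i) c ≤ 2 * r → ∀ l : Fin N, l ≠ i → (7 : ℝ) / 5 < dist (y l) (y i)) →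
            -(2 * (23 / 50) * ((Finset.univ.filter fun i : Fin N => dist (y i) c ≤ 2 * r).card : ℝ) + D * r ^ 2) ≤
              ∑ a ∈ (Finset.univ.filter fun i : Fin N => dist (y i) c ≤ 2 * r),
                  ∑ b ∈ (Finset.univ.filter fun i : Fin N => dist (y i) c ≤ 2 * r), lennardJones (dist (y a) (y b)) +
                2 * ∑ a ∈ (Finset.univ.filter fun i : Fin N => dist (y i) c ≤ 2 * r),
                  ∑ b ∈ (Finset.univ.filter fun i : Fin N => dist (y i) c ≤ 2 * r)ᶜ, lennardJones (dist (y a) (y b)) := by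
  obtain ⟨D, hD⟩ := removalFloor_isolated
  refine ⟨D, fun N y hy hsep c r hr hiso => ?_⟩
  have h := hD N y hy hsep c r hr hiso
  have hc : (0 : ℝ) ≤ ((Finset.univ.filter fun i : Fin N => dist (y i) c ≤ 2 * r).card : ℝ) := Nat.cast_nonneg _
  linarith [h, hc]

/-- **The isolation hypothesis in COUNTING form** (the node's `i ∉ coordMarker 1 N y`): a site with `< 1` other site within `7/5` has all
other sites beyond `7/5`. -/
theorem isolated_of_card_lt_one (y : Fin N → EuclideanSpace ℝ (Fin 3)) {i : Fin N}
    (h : ¬ 1 ≤ (Finset.univ.filter fun l : Fin N => l ≠ i ∧ dist (y l) (y i) ≤ 7 / 5).card) :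
    ∀ l : Fin N, l ≠ i → (7 : ℝ) / 5 < dist (y l) (y i) := by
  intro l hl
  by_contra hle
  apply h
  exact Finset.card_pos.2 ⟨l, Finset.mem_filter.2 ⟨Finset.mem_univ _, hl, not_lt.1 hle⟩⟩

/-- **★ The removal floor of the isolated class in the node's counting form** (hypothesis `¬ 1 ≤ #{l ≠ i : |y_l − y_i| ≤ 7/5}` on the
window; EXACT rate `321875/705894`). -/
theorem removalFloor_coord_one :
    ∃ D : ℝ, ∀ (N : ℕ) (y : Fin N → EuclideanSpace ℝ (Fin 3)), Function.Injective y →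
      (∀ i j : Fin N, i ≠ j → (7 : ℝ) / 10 ≤ dist (y i) (y j)) →
        ∀ (c : EuclideanSpace ℝ (Fin 3)) (r : ℝ), 2 ≤ r →
          (∀ i : Fin N, dist (y i) c ≤ 2 * r →
              ¬ 1 ≤ (Finset.univ.filter fun l : Fin N => l ≠ i ∧ dist (y l) (y i) ≤ 7 / 5).card) →
            -(2 * (321875 / 705894) * ((Finset.univ.filter fun i : Fin N => dist (y i) c ≤ 2 * r).card : ℝ) + D * r ^ 2) ≤
              ∑ a ∈ (Finset.univ.filter fun i : Fin N => dist (y i) c ≤ 2 * r),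
                  ∑ b ∈ (Finset.univ.filter fun i : Fin N => dist (y i) c ≤ 2 * r), lennardJones (dist (y a) (y b)) +
                2 * ∑ a ∈ (Finset.univ.filter fun i : Fin N => dist (y i) c ≤ 2 * r),
                  ∑ b ∈ (Finset.univ.filter fun i : Fin N => dist (y i) c ≤ 2 * r)ᶜ, lennardJones (dist (y a) (y b)) := by
  obtain ⟨D, hD⟩ := removalFloor_isolated
  exact ⟨D, fun N y hy hsep c r hr hiso => hD N y hy hsep c r hr fun i hi => isolated_of_card_lt_one y (hiso i hi)⟩

end Summit.AtomisticToContinuum.Crystallization.Theorems.ContactSaturationLadderSparseRungOne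

end
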